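import Mathlib

/-!
# Anchor constraints forced by a symmetry class

Kernel form of the E₁-INVOLUTION LEMMA used by the ns-blowup refuter (STATUS 2026-08-25
CORRECTION/SHARPENING 12:36–12:41Z, K-CHECK CLAIM N6 part 1): let `M` be a linear isometry of a
real inner product space (the linear part of a symmetry `g` of the ABC host fixing a stagnation
point `x_α`, acting on field values), and let `e` be a direction REVERSED by it, `M e = -e` (the
unstable direction `e₁` at `x_α` is reversed by the three involutions of `Stab(x_α) ≅ S₃`).

* `inner_eq_zero_of_map_eq_self` — a vector FIXED by `M` is orthogonal to `e`.  Reading: a field in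
  the TRIVIAL symmetry class (J–G class I: `w (g x) = M (w x)`) satisfies `w x_α = M (w x_α)` at the
  fixed point, hence `⟪w x_α, e₁⟫ = 0` — class-I modes cannot displace the `α`-points along the
  separatrix and their axial component vanishes there («odd at α»).
* `inner_eq_zero_of_equivariant_of_fixed` — the same, stated for an equivariant field at a fixed
  point of the symmetry.
* `inner_map_eq_neg_of_map_eq_neg` / `inner_eq_neg_of_antiequivariant` — in the SIGN class
  (J–G class II: `w (g x) = - M (w x)` for odd `g`) there is no constraint at a fixed point, but
  between two anchors `x, g x` related by an odd element the components along the transported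
  direction are OPPOSITE: `⟪w (g x), M e⟫ = -⟪w x, e⟫` — the «exact sign alternation over the four
  α» of selfsim's CLAIM N6 (ii) is this identity.
* `inner_map_eq_of_map_eq` — for even elements (or class I) the components agree instead.
* `smul_map_eq_of_equivariant` / `smul_iterate_eq_of_equivariant` — equivariant maps (the NS nonlinearity,
  its time-steppers and flow maps) preserve `Fix(H)`: symmetric data stay symmetric, so isotypic components
  outside `Fix(H)` remain exactly zero along the evolution.

WHAT THIS IS NOT: not a statement about Navier–Stokes; three-line inner-product algebra valid in
any real inner product space.  No new definitions.
-/

namespace Summit.NavierStokesRegularity.FluidComputer.SymmetryClassAnchor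

variable {E : Type*} [NormedAddCommGroup E] [InnerProductSpace ℝ E]

open scoped RealInnerProductSpace

/-- A vector fixed by a linear isometry is orthogonal to every direction the isometry reverses.
[folklore] -/
theorem inner_eq_zero_of_map_eq_self (M : E →ₗᵢ[ℝ] E) {v e : E} (hv : M v = v) (he : M e = -e) :
    ⟪v, e⟫ = 0 := by
  have h : ⟪v, e⟫ = -⟪v, e⟫ := by
    calc ⟪v, e⟫ = ⟪M v, M e⟫ := (M.inner_map_map v e).symm
      _ = -⟪v, e⟫ := by rw [hv, he, inner_neg_right]
  linarith

/-- A vector REVERSED by a linear isometry is orthogonal to every direction the isometry fixes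
(the dual reading: sign-class values at a fixed point are orthogonal to the fixed directions of the
stabiliser element). [folklore] -/
theorem inner_eq_zero_of_map_eq_neg_self (M : E →ₗᵢ[ℝ] E) {v e : E} (hv : M v = -v) (he : M e = e) :
    ⟪v, e⟫ = 0 := by
  have h : ⟪v, e⟫ = -⟪v, e⟫ := by
    calc ⟪v, e⟫ = ⟪M v, M e⟫ := (M.inner_map_map v e).symm
      _ = -⟪v, e⟫ := by rw [hv, he, inner_neg_left]
  linarith

/-- Equivariant fields (trivial class) at a fixed point of the symmetry: if `w (g y) = M (w y)` for
all `y`, `g x = x` and `M e = -e`, then `⟪w x, e⟫ = 0`. [folklore] -/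
theorem inner_eq_zero_of_equivariant_of_fixed {X : Type*} (g : X → X) (M : E →ₗᵢ[ℝ] E)
    (w : X → E) (hw : ∀ y, w (g y) = M (w y)) {x : X} (hx : g x = x) {e : E} (he : M e = -e) :
    ⟪w x, e⟫ = 0 := by
  have hfix : M (w x) = w x := by rw [← hw x, hx]
  exact inner_eq_zero_of_map_eq_self M hfix he

/-- Components along a transported direction AGREE between `x` and `g x` for an equivariant field
(`w (g x) = M (w x)`): `⟪w (g x), M e⟫ = ⟪w x, e⟫`. [folklore] -/
theorem inner_map_eq_of_map_eq (M : E →ₗᵢ[ℝ] E) {a b e : E} (h : b = M a) :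
    ⟪b, M e⟫ = ⟪a, e⟫ := by
  rw [h, M.inner_map_map]

/-- Components along a transported direction are OPPOSITE between `x` and `g x` for an
anti-equivariant field (`w (g x) = - M (w x)`, the sign class under an odd element):
`⟪w (g x), M e⟫ = -⟪w x, e⟫`. [folklore] -/
theorem inner_map_eq_neg_of_map_eq_neg (M : E →ₗᵢ[ℝ] E) {a b e : E} (h : b = -M a) :
    ⟪b, M e⟫ = -⟪a, e⟫ := by
  rw [h, inner_neg_left, M.inner_map_map]

/-- The «sign alternation» of sign-class fields: if `w (g y) = - M (w y)` for all `y` (odd element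
`g`), then at any point `⟪w (g x), M e⟫ = -⟪w x, e⟫`; in particular with `e = e₁(x)` and
`M e₁(x) = e₁(g x)` (the symmetry transports unstable directions) the `e₁`-components at the two
anchors `x`, `g x` are opposite. [folklore] -/
theorem inner_eq_neg_of_antiequivariant {X : Type*} (g : X → X) (M : E →ₗᵢ[ℝ] E) (w : X → E)
    (hw : ∀ y, w (g y) = -M (w y)) (x : X) (e : E) :
    ⟪w (g x), M e⟫ = -⟪w x, e⟫ :=
  inner_map_eq_neg_of_map_eq_neg M (hw x)

/-- And at a FIXED point of an odd element a sign-class field is reversed, `M (w x) = - w x`, so it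
is orthogonal to every direction that element fixes (e.g. the rotation axis of the involution),
while its component along the reversed direction `e₁` is unconstrained. [folklore] -/
theorem inner_eq_zero_of_antiequivariant_of_fixed {X : Type*} (g : X → X) (M : E →ₗᵢ[ℝ] E)
    (w : X → E) (hw : ∀ y, w (g y) = -M (w y)) {x : X} (hx : g x = x) {a : E} (ha : M a = a) :
    ⟪w x, a⟫ = 0 := by
  have h1 := hw x
  rw [hx] at h1
  -- h1 : w x = -M (w x)
  exact inner_eq_zero_of_map_eq_neg_self M (neg_eq_iff_eq_neg.mp h1.symm) ha

/-- Equivariant maps preserve fixed points of the action: if `N (g • u) = g • N u` for all `g, u` and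
`g • u = u`, then `g • N u = N u`.  Reading: the Navier–Stokes nonlinearity and the linearisation about a
`g`-invariant base flow are equivariant, so `Fix(H)`-data stay `Fix(H)`-data for every subgroup `H` of the
host's symmetry group — the isotypic components outside `Fix(H)` remain exactly zero (refuter SHARPENING
12:41Z row (iii); ENGINE-2′-NL selftest j239204: 6e-16). [folklore] -/
theorem smul_map_eq_of_equivariant {G X : Type*} [SMul G X] (N : X → X)
    (hN : ∀ (g : G) (u : X), N (g • u) = g • N u) {g : G} {u : X} (hu : g • u = u) :
    g • N u = N u := by
  rw [← hN, hu]

/-- The same along iterates (time steps / the flow map at integer times): fixed data stay fixed.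
[folklore] -/
theorem smul_iterate_eq_of_equivariant {G X : Type*} [SMul G X] (N : X → X)
    (hN : ∀ (g : G) (u : X), N (g • u) = g • N u) {g : G} {u : X} (hu : g • u = u) (n : ℕ) :
    g • (N^[n] u) = N^[n] u := by
  induction n with
  | zero => simpa using hu
  | succ n ih =>
    rw [Function.iterate_succ_apply']
    exact smul_map_eq_of_equivariant N hN ih

end Summit.NavierStokesRegularity.FluidComputer.SymmetryClassAnchor
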